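import Summits.Schanuel.Schanuel.Theorems.SoloInformedSymmetricIntegrality

/-!
# Integrality of the equation of squared differences (Lemma AE (i) in kernel form)

Solo-informed Schanuel seat, session s177 (2026-08-31); companion of
`SoloInformedSymmetricIntegrality` (degree-bounded fundamental theorem of symmetric polynomials,
`a ^ m · P(roots) ∈ ℤ`).  `Mathlib` + that file only; no definition is introduced; audit class:
none (no literature hypotheses); classical algebra, no novelty claimed.

## Setting

`F : ℤ[X]` with `natDegree F = D`, leading coefficient `a`, roots `ρ : Fin D → K` enumerated with
multiplicity (`univ.val.map ρ = (F.map (Int.castRingHom K)).roots`) in a domain `K` of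
characteristic zero.  For a finset `p ⊆ Fin D` put `θ p := (Σ_{i∈p} ρ i)² − 4 ∏_{i∈p} ρ i`; on a
pair `p = {i, j}` this is `(ρ i − ρ j)²` (`soloSD_theta_pair`) — a choice-free symmetric
expression, so that no ordering of a `2`-subset is ever needed.  The theorems take `θ` as a
function together with the hypothesis `hθ : ∀ p, θ p = …` (no definitions).  Index set: ORDERED
pairs `q = (p, p')` of `2`-subsets of `Fin D` (the type `{p : Finset (Fin D) // p.card = 2}²`).

## Results

* `soloSD_pow_mul_prod_sub_eq_intCast` — **algebraic core** (any domain `K`, `CharZero K`,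
  `DecidableEq K`): `a ^ (2 D (D-1)²) · ∏_{q : θ q.1 ≠ θ q.2} (θ q.1 − θ q.2) = N` for some
  `N : ℤ`.
* `soloSD_one_le_abs_pow_mul_prod_norm_sub` — **Lemma AE (i)** over `ℂ`, `F ≠ 0`:
  `1 ≤ |a| ^ (2 D (D-1)²) · ∏_{q : θ q.1 ≠ θ q.2} ‖θ q.1 − θ q.2‖`.  The product over ordered
  pairs is `|E|²` for `E := ∏ (θ_p − θ_{p'})` over unordered pairs of DISTINCT VALUES, so this is
  `|E| ≥ |a| ^ (−D (D-1)²)`.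
* Pieces: `soloSD_sum_powersetCard_prod_eq_prod_filter` (VALUE LEMMA: over a finset, the
  elementary symmetric function of degree `k = #{non-zero values}` of a family of values equals
  the product of the non-zero values — every other `k`-subset contains a zero);
  `soloSD_rename_aeval_esymm_eq`, `soloSD_aeval_aeval_esymm`, `soloSD_degreeOf_aeval_esymm_le`
  (elementary symmetric polynomials with polynomials substituted: invariance under `rename`,
  evaluation, degree in one variable); `soloSD_rename_theta`, `soloSD_degreeOf_theta_le`
  (`degreeOf i ≤ 2` if `i ∈ p`, `= 0` otherwise), `soloSD_card_pairs_containing_le` (`≤ D − 1`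
  two-subsets contain `i`), `soloSD_card_pairs` (`D.choose 2`), `soloSD_sum_degreeOf_thetaDiff_le`
  (total degree budget `2 D (D-1)²`), `soloSD_isSymmetric_thetaDiff_esymm`.

## Mechanism (λ-free version of AE-note §2 (i))

Let `x_q := Θ_{q.1} − Θ_{q.2} ∈ ℤ[X₀,…,X_{D-1}]` for ALL ordered pairs `q` (the diagonal and the
pairs with equal values simply evaluate to `0`), and `P := e_k(x)` — the `k`-th elementary
symmetric polynomial in `C(D,2)²` letters with the `x_q` substituted — where `k` is the number
of ordered pairs with `θ q.1 ≠ θ q.2`.  (1) `P` is symmetric in `X₀,…,X_{D-1}`: a permutation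
`σ` of the variables permutes the `2`-subsets (`p ↦ σ(p)`), hence the ordered pairs, and `e_k`
is invariant under permuting its letters (`MvPolynomial.rename_esymm`).  (2) `P(ρ) = e_k` of the
VALUES `= ∏_{θ q.1 ≠ θ q.2} (θ q.1 − θ q.2)` by the value lemma.  (3) `degreeOf i P ≤ Σ_q
degreeOf i x_q ≤ Σ_{(p,p')} (2·[i∈p] + 2·[i∈p']) = 4 · C(D,2) · #{p ∋ i} ≤ 4 · C(D,2) · (D−1)
= 2 D (D−1)²`.  Then `SoloInformedSymmetricIntegrality` gives `a ^ (2 D (D-1)²) · P(ρ) ∈ ℤ`, and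
over `ℂ` the product is non-zero, whence `≥ 1` in absolute value after multiplying by `|a|^m`.

## Exponent bookkeeping against AE-note §2

The note's exponent is `m₁ = (D−1)(D−2)(2D−1)` (per-variable degree of `Φ(λ)`, using the
cancellation of `X₁²` in `Θ_{1i} − Θ_{1j}`); this file uses the cruder `m₂ = 2 D (D−1)² =
4 (D−1) C(D,2)` (no cancellation count: `degreeOf i (Θ_p − Θ_{p'}) ≤ 2[i∈p] + 2[i∈p']`).  In step
(iii) of Lemma AE the coefficient of `log |a|` becomes `m₂/2 − 2(D₂−1)(D−1) = D(D−1)² −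
(D−2)(D+1)(D−1) = 2(D−1) ≥ 0` (instead of `−(3/2)(D−1)(D−2) ≤ 0`) and is absorbed by
`0 ≤ log |a| ≤ log M(F)`: the resulting coefficient of `log M(F)` is `(D−2)(D+1)(D−1) + 2(D−1) =
D(D−1)²`, i.e. EXACTLY the constant of (AE) `N′·log(1/ε′) ≤ D(D−1)²·log M(F) + 0.44·D²(D−1)²`.
So Lemma AE as stated (`run/shared/lean/ideation/Schanuel/solo-informed/paper/AE-note.md` §2)
follows from this file, the Mahler-measure bookkeeping (ii) (Mathlib: `Polynomial.mahlerMeasure`,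
`Polynomial.logMahlerMeasure_eq_log_leadingCoeff_add_sum_log_roots`) and the arithmetic (iii);
(ii)–(iii) are not formalised here.  Nothing in this file bears on the summit statement
`Literature.Periods.SchanuelConjecture` beyond this bookkeeping for the seat's toy line (node
`RoyAdditiveDirichletExponent`); the seat's verdict (no path) is unchanged.

Literature: the integrality-of-symmetric-functions-of-roots device is the classical one of
transcendence proofs, e.g. [cite: Baker1975, Ch. 8 §3, p. 84]
[corpus: book:baker1975-transcendental-number-theory p.84]; [cite: Angell2021, Cor 5.6 p. 133]
[corpus: book:angell2022-irrationality-transcendence-number-theory p.133].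
-/

namespace Summit.Schanuel.Schanuel.Theorems

open MvPolynomial Finset

section GenericPieces

/-- **Value lemma.**  Over a finset `I`, the elementary symmetric function of the values `y q`
of degree `k = #{q ∈ I | y q ≠ 0}` is the product of the non-zero values. -/
theorem soloSD_sum_powersetCard_prod_eq_prod_filter {ι R : Type*} [CommRing R] [DecidableEq ι]
    (I : Finset ι) (y : ι → R) [DecidablePred fun q => y q ≠ 0] :
    ∑ T ∈ I.powersetCard #(I.filter fun q => y q ≠ 0), ∏ q ∈ T, y q
      = ∏ q ∈ I.filter (fun q => y q ≠ 0), y q := by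
  set J := I.filter (fun q => y q ≠ 0) with hJ
  have hJmem : J ∈ I.powersetCard #J := by
    rw [Finset.mem_powersetCard]; exact ⟨Finset.filter_subset _ _, rfl⟩
  rw [Finset.sum_eq_single_of_mem J hJmem]
  intro T hT hne
  rw [Finset.mem_powersetCard] at hT
  obtain ⟨hTI, hcard⟩ := hT
  have hnot : ¬ T ⊆ J := fun h => hne (Finset.eq_of_subset_of_card_le h (by rw [hcard]))
  obtain ⟨q, hqT, hqJ⟩ := Finset.not_subset.mp hnot
  apply Finset.prod_eq_zero hqT
  by_contra h
  exact hqJ (Finset.mem_filter.mpr ⟨hTI hqT, h⟩)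

/-- Substituting polynomials `x q` into the `k`-th elementary symmetric polynomial gives a
polynomial fixed by `rename e` as soon as `rename e` permutes the family `x` (via some
bijection `G` of the index type). -/
theorem soloSD_rename_aeval_esymm_eq {σ τ R : Type*} [CommRing R] [Fintype τ] (e : σ → σ)
    (x : τ → MvPolynomial σ R) (G : τ ≃ τ) (hx : ∀ q, rename e (x q) = x (G q)) (k : ℕ) :
    rename e (aeval x (esymm τ R k)) = aeval x (esymm τ R k) := by
  have h1 : (rename e).comp (aeval x) = aeval (fun q => rename e (x q)) :=
    MvPolynomial.algHom_ext fun q => by simp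
  have h2 : (fun q => rename e (x q)) = x ∘ G := funext hx
  rw [← AlgHom.comp_apply, h1, h2, ← aeval_rename, rename_esymm]

/-- Evaluating the substituted elementary symmetric polynomial. -/
theorem soloSD_aeval_aeval_esymm {σ τ R S : Type*} [CommRing R] [CommRing S] [Algebra R S]
    [Fintype τ] (x : τ → MvPolynomial σ R) (f : σ → S) (k : ℕ) :
    aeval f (aeval x (esymm τ R k)) = ∑ T ∈ univ.powersetCard k, ∏ q ∈ T, aeval f (x q) := by
  simp only [MvPolynomial.esymm, map_sum, map_prod, aeval_X]

/-- Degree of the substituted elementary symmetric polynomial in one variable: at most the sum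
of the degrees of the substituted polynomials. -/
theorem soloSD_degreeOf_aeval_esymm_le {σ τ R : Type*} [CommRing R] [Fintype τ]
    (x : τ → MvPolynomial σ R) (i : σ) (k : ℕ) :
    degreeOf i (aeval x (esymm τ R k)) ≤ ∑ q, degreeOf i (x q) := by
  classical
  simp only [MvPolynomial.esymm, map_sum, map_prod, aeval_X]
  refine (degreeOf_sum_le _ _ _).trans (Finset.sup_le fun T _ => (degreeOf_prod_le _ _ _).trans ?_)
  exact Finset.sum_le_sum_of_subset (Finset.subset_univ T)

end GenericPieces

section Theta

variable {D : ℕ}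

/-- The symmetric expression `(Σ_{i∈p} Xᵢ)² − 4 ∏_{i∈p} Xᵢ` equals `(Xᵢ − Xⱼ)²` on a pair
`p = {i, j}`. -/
theorem soloSD_theta_pair {R : Type*} [CommRing R] (r : Fin D → R) {i j : Fin D} (hij : i ≠ j) :
    (∑ l ∈ ({i, j} : Finset (Fin D)), r l) ^ 2 - 4 * ∏ l ∈ ({i, j} : Finset (Fin D)), r l
      = (r i - r j) ^ 2 := by
  rw [Finset.sum_pair hij, Finset.prod_pair hij]; ring

/-- `rename σ` maps the expression attached to `p` to the one attached to `σ(p)`. -/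
theorem soloSD_rename_theta (σ : Equiv.Perm (Fin D)) (p : Finset (Fin D)) :
    rename σ ((∑ i ∈ p, X i) ^ 2 - 4 * ∏ i ∈ p, X i : MvPolynomial (Fin D) ℤ)
      = (∑ i ∈ p.map σ.toEmbedding, X i) ^ 2 - 4 * ∏ i ∈ p.map σ.toEmbedding, X i := by
  simp only [map_sub, map_pow, map_mul, map_sum, map_prod, rename_X, Finset.sum_map,
    Finset.prod_map, Equiv.coe_toEmbedding, map_ofNat]

/-- Degree count: the expression attached to `p` has degree `≤ 2` in `Xᵢ` if `i ∈ p` and does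
not involve `Xᵢ` otherwise. -/
theorem soloSD_degreeOf_theta_le (i : Fin D) (p : Finset (Fin D)) :
    degreeOf i ((∑ j ∈ p, X j) ^ 2 - 4 * ∏ j ∈ p, X j : MvPolynomial (Fin D) ℤ)
      ≤ if i ∈ p then 2 else 0 := by
  classical
  have hX : ∀ j : Fin D, degreeOf i (X j : MvPolynomial (Fin D) ℤ) ≤ if i = j then 1 else 0 := by
    intro j
    split_ifs with h
    · subst h; simp
    · rw [degreeOf_X_of_ne h]
  have hsum : degreeOf i (∑ j ∈ p, X j : MvPolynomial (Fin D) ℤ) ≤ if i ∈ p then 1 else 0 := by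
    refine (degreeOf_sum_le _ _ _).trans (Finset.sup_le fun j hj => (hX j).trans ?_)
    by_cases h : i = j
    · subst h; simp [hj]
    · simp [h]
  have hprod : degreeOf i (∏ j ∈ p, X j : MvPolynomial (Fin D) ℤ) ≤ if i ∈ p then 1 else 0 := by
    refine (degreeOf_prod_le _ _ _).trans ?_
    calc ∑ j ∈ p, degreeOf i (X j : MvPolynomial (Fin D) ℤ)
        ≤ ∑ j ∈ p, (if i = j then 1 else 0) := Finset.sum_le_sum fun j _ => hX j
      _ = if i ∈ p then 1 else 0 := Finset.sum_ite_eq p i (fun _ => 1)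
  have h4 : degreeOf i (4 : MvPolynomial (Fin D) ℤ) = 0 := by
    rw [← map_ofNat (C : ℤ →+* MvPolynomial (Fin D) ℤ) 4]; exact degreeOf_C _ _
  refine (degreeOf_sub_le _ _ _).trans (max_le ?_ ?_)
  · refine (degreeOf_pow_le _ _ _).trans ?_
    split_ifs with h
    · rw [if_pos h] at hsum; omega
    · rw [if_neg h] at hsum; omega
  · refine (degreeOf_mul_le _ _ _).trans ?_
    rw [h4, zero_add]
    refine hprod.trans ?_
    split_ifs <;> omega

/-- The number of `2`-subsets of `Fin D` containing a given index is at most `D - 1`. -/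
theorem soloSD_card_pairs_containing_le (i : Fin D) :
    #((univ : Finset {p : Finset (Fin D) // p.card = 2}).filter fun p => i ∈ p.1) ≤ D - 1 := by
  classical
  have hinj : Set.InjOn (fun p : {p : Finset (Fin D) // p.card = 2} => p.1.erase i)
      ↑((univ : Finset {p : Finset (Fin D) // p.card = 2}).filter fun p => i ∈ p.1) := by
    intro p hp p' hp' h
    simp only [Finset.coe_filter, Finset.mem_univ, true_and, Set.mem_setOf_eq] at hp hp'
    apply Subtype.ext
    rw [← Finset.insert_erase hp, ← Finset.insert_erase hp']
    exact congrArg _ h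
  have hmaps : ∀ p ∈ (univ : Finset {p : Finset (Fin D) // p.card = 2}).filter (fun p => i ∈ p.1),
      (fun p : {p : Finset (Fin D) // p.card = 2} => p.1.erase i) p
        ∈ (univ.erase i).powersetCard 1 := by
    intro p hp
    simp only [Finset.mem_filter, Finset.mem_univ, true_and] at hp
    rw [Finset.mem_powersetCard]
    refine ⟨fun j hj => ?_, ?_⟩
    · rw [Finset.mem_erase] at hj ⊢
      exact ⟨hj.1, Finset.mem_univ _⟩
    · rw [Finset.card_erase_of_mem hp, p.2]
  calc #((univ : Finset {p : Finset (Fin D) // p.card = 2}).filter fun p => i ∈ p.1)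
      ≤ #((univ.erase i : Finset (Fin D)).powersetCard 1) :=
        Finset.card_le_card_of_injOn _ hmaps hinj
    _ = D - 1 := by
        rw [Finset.card_powersetCard, Finset.card_erase_of_mem (Finset.mem_univ i),
          Finset.card_univ, Fintype.card_fin, Nat.choose_one_right]

/-- `Fintype.card` of the `2`-subsets of `Fin D` is `D.choose 2`. -/
theorem soloSD_card_pairs : Fintype.card {p : Finset (Fin D) // p.card = 2} = D.choose 2 := by
  classical
  rw [Fintype.card_subtype]
  have : (univ : Finset (Finset (Fin D))).filter (fun p => p.card = 2) = univ.powersetCard 2 := by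
    rw [Finset.powersetCard_eq_filter, Finset.powerset_univ]
  rw [this, Finset.card_powersetCard, Finset.card_univ, Fintype.card_fin]

end Theta


section Main

variable {D : ℕ}

/-- Degree budget: summed over all ordered pairs `(p, p')` of `2`-subsets, the `Xᵢ`-degrees of
the differences `Θ_p − Θ_{p'}` total at most `2 D (D-1)²`. -/
theorem soloSD_sum_degreeOf_thetaDiff_le (i : Fin D) :
    ∑ q : {p : Finset (Fin D) // p.card = 2} × {p : Finset (Fin D) // p.card = 2},
        degreeOf i ((((∑ j ∈ q.1.1, X j) ^ 2 - 4 * ∏ j ∈ q.1.1, X j)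
            - ((∑ j ∈ q.2.1, X j) ^ 2 - 4 * ∏ j ∈ q.2.1, X j)) : MvPolynomial (Fin D) ℤ)
      ≤ 2 * D * (D - 1) ^ 2 := by
  classical
  set f : {p : Finset (Fin D) // p.card = 2} → ℕ := fun p => if i ∈ p.1 then 2 else 0 with hf
  have hq : ∀ q : {p : Finset (Fin D) // p.card = 2} × {p : Finset (Fin D) // p.card = 2},
      degreeOf i ((((∑ j ∈ q.1.1, X j) ^ 2 - 4 * ∏ j ∈ q.1.1, X j)
            - ((∑ j ∈ q.2.1, X j) ^ 2 - 4 * ∏ j ∈ q.2.1, X j)) : MvPolynomial (Fin D) ℤ)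
        ≤ f q.1 + f q.2 := by
    intro q
    refine (degreeOf_sub_le _ _ _).trans (max_le ?_ ?_)
    · exact (soloSD_degreeOf_theta_le i q.1.1).trans (Nat.le_add_right _ _)
    · exact (soloSD_degreeOf_theta_le i q.2.1).trans (Nat.le_add_left _ _)
  have hfsum : ∑ p, f p
      = 2 * #((univ : Finset {p : Finset (Fin D) // p.card = 2}).filter fun p => i ∈ p.1) := by
    rw [hf, ← Finset.sum_filter, Finset.sum_const, smul_eq_mul, mul_comm]
  have hA := soloSD_card_pairs_containing_le (D := D) i
  have hcard : Fintype.card {p : Finset (Fin D) // p.card = 2} = D.choose 2 := soloSD_card_pairs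
  have h2 : D.choose 2 * 2 = D * (D - 1) := by
    rw [Nat.choose_two_right, Nat.div_two_mul_two_of_even (Nat.even_mul_pred_self D)]
  calc ∑ q : {p : Finset (Fin D) // p.card = 2} × {p : Finset (Fin D) // p.card = 2},
        degreeOf i ((((∑ j ∈ q.1.1, X j) ^ 2 - 4 * ∏ j ∈ q.1.1, X j)
            - ((∑ j ∈ q.2.1, X j) ^ 2 - 4 * ∏ j ∈ q.2.1, X j)) : MvPolynomial (Fin D) ℤ)
      ≤ ∑ q : {p : Finset (Fin D) // p.card = 2} × {p : Finset (Fin D) // p.card = 2},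
          (f q.1 + f q.2) := Finset.sum_le_sum fun q _ => hq q
    _ = 2 * (Fintype.card {p : Finset (Fin D) // p.card = 2} * ∑ p, f p) := by
        rw [Finset.sum_add_distrib, Fintype.sum_prod_type, Fintype.sum_prod_type]
        simp only [Finset.sum_const, smul_eq_mul, Finset.card_univ, ← Finset.mul_sum]
        ring
    _ ≤ 2 * (D.choose 2 * (2 * (D - 1))) := by
        rw [hcard, hfsum]; gcongr
    _ = 2 * D * (D - 1) ^ 2 := by
        calc 2 * (D.choose 2 * (2 * (D - 1))) = 2 * ((D.choose 2 * 2) * (D - 1)) := by ring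
          _ = 2 * D * (D - 1) ^ 2 := by rw [h2]; ring

/-- The substituted elementary symmetric polynomials of the differences `Θ_p − Θ_{p'}` are
symmetric in `X₀, …, X_{D-1}`: a permutation of the variables permutes the `2`-subsets, hence
the ordered pairs of `2`-subsets. -/
theorem soloSD_isSymmetric_thetaDiff_esymm (k : ℕ) :
    (aeval (fun q : {p : Finset (Fin D) // p.card = 2} × {p : Finset (Fin D) // p.card = 2} =>
        ((((∑ j ∈ q.1.1, X j) ^ 2 - 4 * ∏ j ∈ q.1.1, X j)
            - ((∑ j ∈ q.2.1, X j) ^ 2 - 4 * ∏ j ∈ q.2.1, X j)) : MvPolynomial (Fin D) ℤ))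
      (esymm ({p : Finset (Fin D) // p.card = 2} × {p : Finset (Fin D) // p.card = 2}) ℤ k)
      ).IsSymmetric := by
  intro σ
  let g : {p : Finset (Fin D) // p.card = 2} ≃ {p : Finset (Fin D) // p.card = 2} :=
    (Equiv.finsetCongr σ).subtypeEquiv fun p => by
      simp [Equiv.finsetCongr_apply, Finset.card_map]
  refine soloSD_rename_aeval_esymm_eq σ _ (Equiv.prodCongr g g) (fun q => ?_) k
  rw [map_sub, soloSD_rename_theta, soloSD_rename_theta]
  rfl

/-- **Integrality of the equation of squared differences (algebraic core).**  Over any domain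
`K` of characteristic zero: let `F : ℤ[X]` have `natDegree F = D` and leading coefficient `a`,
let `ρ : Fin D → K` enumerate the roots of `F` in `K` with multiplicity, and for a finset `p` put
`θ p = (Σ_{i∈p} ρ i)² − 4 ∏_{i∈p} ρ i` (so `θ {i, j} = (ρ i − ρ j)²`).  Then
`a ^ (2 D (D-1)²) · ∏ (θ p − θ p')`, the product over the ORDERED pairs `(p, p')` of `2`-subsets
of `Fin D` with `θ p ≠ θ p'`, is a rational integer. -/
theorem soloSD_pow_mul_prod_sub_eq_intCast {K : Type*} [CommRing K] [IsDomain K] [CharZero K]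
    [DecidableEq K]
    (F : Polynomial ℤ) (hD : F.natDegree = D) (ρ : Fin D → K)
    (hρ : univ.val.map ρ = (F.map (Int.castRingHom K)).roots)
    (θ : Finset (Fin D) → K) (hθ : ∀ p, θ p = (∑ i ∈ p, ρ i) ^ 2 - 4 * ∏ i ∈ p, ρ i) :
    ∃ N : ℤ, (F.leadingCoeff : K) ^ (2 * D * (D - 1) ^ 2) *
      ∏ q ∈ (univ :
          Finset ({p : Finset (Fin D) // p.card = 2} × {p : Finset (Fin D) // p.card = 2}))
        with θ q.1.1 ≠ θ q.2.1, (θ q.1.1 - θ q.2.1) = N := by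
  -- the substituted family `x q = Θ_{q.1} − Θ_{q.2}` (kept opaque) and its values
  obtain ⟨x, hx⟩ : ∃ x : {p : Finset (Fin D) // p.card = 2} × {p : Finset (Fin D) // p.card = 2} →
      MvPolynomial (Fin D) ℤ, x = fun q => (((∑ j ∈ q.1.1, X j) ^ 2 - 4 * ∏ j ∈ q.1.1, X j)
            - ((∑ j ∈ q.2.1, X j) ^ 2 - 4 * ∏ j ∈ q.2.1, X j)) := ⟨_, rfl⟩
  have hy : ∀ q, aeval ρ (x q) = θ q.1.1 - θ q.2.1 := by
    intro q
    simp only [hx, hθ, map_sub, map_pow, map_mul, map_sum, map_prod, aeval_X, map_ofNat]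
  -- the ordered pairs with distinct values
  obtain ⟨J, hJ⟩ :
      ∃ J : Finset ({p : Finset (Fin D) // p.card = 2} × {p : Finset (Fin D) // p.card = 2}),
      J = univ.filter (fun q => θ q.1.1 - θ q.2.1 ≠ 0) := ⟨_, rfl⟩
  have hJeq : (univ :
      Finset ({p : Finset (Fin D) // p.card = 2} × {p : Finset (Fin D) // p.card = 2})).filter
        (fun q => θ q.1.1 ≠ θ q.2.1) = J := by
    rw [hJ]; exact Finset.filter_congr fun q _ => sub_ne_zero.symm
  -- the symmetric integer polynomial whose value at `ρ` is the product over `J`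
  obtain ⟨P, hP⟩ : ∃ P : MvPolynomial (Fin D) ℤ, P = aeval x
      (esymm ({p : Finset (Fin D) // p.card = 2} × {p : Finset (Fin D) // p.card = 2}) ℤ #J) :=
    ⟨_, rfl⟩
  have hPsymm : P.IsSymmetric := by
    rw [hP, hx]; exact soloSD_isSymmetric_thetaDiff_esymm (D := D) #J
  have hm : ∀ i, P.degreeOf i ≤ 2 * D * (D - 1) ^ 2 := by
    intro i
    rw [hP]
    refine (soloSD_degreeOf_aeval_esymm_le x i _).trans ?_
    rw [hx]
    exact soloSD_sum_degreeOf_thetaDiff_le i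
  have hval : aeval ρ P = ∏ q ∈ J, (θ q.1.1 - θ q.2.1) := by
    rw [hP, soloSD_aeval_aeval_esymm]
    simp_rw [hy]
    rw [hJ]
    exact soloSD_sum_powersetCard_prod_eq_prod_filter _ _
  obtain ⟨N, hN⟩ := soloSI_leadingCoeff_pow_mul_aeval_roots_eq_intCast F hD ρ hρ P hPsymm hm
  refine ⟨N, ?_⟩
  rw [hJeq, ← hval]
  exact hN

/-- **Lemma AE (i), kernel form.**  Over `ℂ`, with `F ≠ 0`: the product of `‖θ p − θ p'‖`
over the ordered pairs `(p, p')` of `2`-subsets with `θ p ≠ θ p'` — this is `|E|²` for the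
product `E` of the differences of the distinct VALUES `(ρ i − ρ j)²` over unordered pairs —
satisfies `|a| ^ (2 D (D-1)²) · |E|² ≥ 1`. -/
theorem soloSD_one_le_abs_pow_mul_prod_norm_sub (F : Polynomial ℤ) (hF : F ≠ 0)
    (hD : F.natDegree = D) (ρ : Fin D → ℂ)
    (hρ : univ.val.map ρ = (F.map (Int.castRingHom ℂ)).roots)
    (θ : Finset (Fin D) → ℂ) (hθ : ∀ p, θ p = (∑ i ∈ p, ρ i) ^ 2 - 4 * ∏ i ∈ p, ρ i) :
    1 ≤ |(F.leadingCoeff : ℝ)| ^ (2 * D * (D - 1) ^ 2) *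
      ∏ q ∈ (univ :
          Finset ({p : Finset (Fin D) // p.card = 2} × {p : Finset (Fin D) // p.card = 2}))
        with θ q.1.1 ≠ θ q.2.1, ‖θ q.1.1 - θ q.2.1‖ := by
  obtain ⟨N, hN⟩ := soloSD_pow_mul_prod_sub_eq_intCast F hD ρ hρ θ hθ
  have ha : (F.leadingCoeff : ℂ) ≠ 0 := by exact_mod_cast Polynomial.leadingCoeff_ne_zero.mpr hF
  have hN0 : N ≠ 0 := by
    rintro rfl
    rw [Int.cast_zero, mul_eq_zero] at hN
    rcases hN with h | h
    · exact pow_ne_zero _ ha h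
    · exact (Finset.prod_ne_zero_iff.mpr
        (fun q hq => sub_ne_zero.mpr (Finset.mem_filter.mp hq).2)) h
  have hnorm := congrArg norm hN
  rw [norm_mul, norm_pow, Complex.norm_intCast, norm_prod, Complex.norm_intCast] at hnorm
  rw [hnorm]
  exact_mod_cast Int.one_le_abs hN0

end Main

end Summit.Schanuel.Schanuel.Theorems
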